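import Literature.Analysis.FluidPDE.PassiveScalarLimitL2Drift
import HarnessLib

/-!
# Identification of weak limits of weak passive scalars, `L²_{t,x}` drift

Analysis/FluidPDE proof-support file (everything proved; no definitions, no named facts), fifth of
the files discharging `MescoliniPitchoSorella2025_thm24` (Mescolini–Pitcho–Sorella, Ann. Mat. Pura
Appl. 204 (2025), Thm. 2.4: existence of bounded weak solutions of `∂ₜρ + b·∇ρ = νΔρ` along a drift
`b ∈ L²((0,T) × T^d)`). The tree's stability theorems for the passage to the limit in the linear
transport–diffusion equation (`IsWeakScalarTransportOn.of_tendsto` for a bounded limit drift,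
`IsWeakScalarTransportOn.of_tendsto_of_lintegral_sq_le` for `u ∈ L^∞(0,T; L²(T^d))`,
`PassiveScalarLimitL2Drift`) are run here for a limit drift that is merely square integrable on
`(0,T) × T^d`: `IsWeakScalarTransportOn.of_tendsto_of_lintegral_lintegral_sq_lt_top`. The weak
convergence argument is unchanged (the test integrand `∂ₜψ + u·∇ψ + κΔψ` is square integrable on
`(0,T) × T^d`); only the class bookkeeping `u ∈ L¹(0,T; L²)`, `uW ∈ L¹((0,T) × T^d)` is now obtained
by Cauchy–Schwarz in time on the finite interval instead of from an a.e. bound.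

## References

* R. J. DiPerna, P.-L. Lions, Invent. Math. 98 (1989), Prop. II.1 and Thm. II.3 (proofs).
  [`DiPernaLions1989`]
* G. Mescolini, J. Pitcho, M. Sorella, Ann. Mat. Pura Appl. (4) 204 (2025) 1667–1687, Thm. 2.4 and
  Prop. 2.5 (weak-* compactness and passage to the limit for `b ∈ L²_{t,x}`). [`MescoliniPitchoSorella2025`]
-/

noncomputable section

open MeasureTheory TopologicalSpace Set Function Filter Metric
open _root_.Topology
open scoped ENNReal NNReal InnerProductSpace

namespace Literature.Analysis.FluidPDE

namespace Torus

variable {d : Type*} [Fintype d]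

section Limit

variable {T κ : ℝ} {C : ℝ≥0} {u : ℝ → UnitAddTorus d → EuclideanSpace ℝ d}
  {v : ℕ → ℝ → UnitAddTorus d → EuclideanSpace ℝ d} {θ₀ : UnitAddTorus d → ℝ}
  {g : ℕ → UnitAddTorus d → ℝ} {θ : ℕ → ℝ → UnitAddTorus d → ℝ} {W : ℝ → UnitAddTorus d → ℝ}

/-- **Stability of weak solutions under weak-* convergence, `L²_{t,x}` drift** (the passage to
the limit of DiPerna–Lions 1989, proof of Prop. II.1 / Thm. II.3, here for a limit drift
`u ∈ L²((0,T) × T^d)` — the class of Mescolini–Pitcho–Sorella 2025, Thm. 2.4 — rather than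
`L^∞(0,T; L²(T^d))`): weak solutions `θₙ` of `∂ₜθₙ + vₙ·∇θₙ = κΔθₙ` with data `gₙ`, uniformly bounded in
`L^∞(0,T;L²)`, converging weakly in `L²((0,T) × T^d)` to `W`; `vₙ → u` in `L²((0,T) × T^d)`,
`gₙ → θ₀` in `L²`; then `W` is a weak solution with drift `u` and datum `θ₀`. Same proof as
`IsWeakScalarTransportOn.of_tendsto_of_lintegral_sq_le`; the class bookkeeping `u ∈ L¹_t L²_x`,
`uW ∈ L¹_{t,x}` now comes from Cauchy–Schwarz in time on the finite interval.
[cite: DiPernaLions1989, Thm. II.3, proof (p. 522)] -/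
theorem IsWeakScalarTransportOn.of_tendsto_of_lintegral_lintegral_sq_lt_top
    (hsol : ∀ n, IsWeakScalarTransportOn T κ (v n) (g n) (θ n))
    (hbd : ∀ n, ∀ᵐ t ∂(volume.restrict (Ioo 0 T)), ∫⁻ x, ‖θ n t x‖ₑ ^ 2 ≤ C)
    (hWm : AEStronglyMeasurable (FunctionSpaces.Torus.stLift W) (volume.restrict (Ioo 0 T ×ˢ univ)))
    (hWb : ∀ᵐ t ∂(volume.restrict (Ioo 0 T)), ∫⁻ x, ‖W t x‖ₑ ^ 2 ≤ C)
    (hlim : ∀ G : ℝ → UnitAddTorus d → ℝ,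
      AEStronglyMeasurable (FunctionSpaces.Torus.stLift G) (volume.restrict (Ioo 0 T ×ˢ univ)) →
      ∫⁻ t in Ioo 0 T, ∫⁻ x, ‖G t x‖ₑ ^ 2 < ⊤ →
      Tendsto (fun n => ∫ t in Ioo 0 T, ∫ x, θ n t x * G t x) atTop
        (𝓝 (∫ t in Ioo 0 T, ∫ x, W t x * G t x)))
    (hum0 : AEStronglyMeasurable (FunctionSpaces.Torus.stLift u) (volume.restrict (Ioo 0 T ×ˢ univ)))
    (hu2 : ∫⁻ t in Ioo 0 T, ∫⁻ x, ‖u t x‖ₑ ^ 2 < ⊤)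
    (hdiv : ∀ᵐ t ∂(volume.restrict (Ioo 0 T)), FunctionSpaces.Torus.IsWeaklyDivFree (u t))
    (hv : Tendsto (fun n => eLpNorm (fun q : ℝ × UnitAddTorus d => v n q.1 q.2 - u q.1 q.2) 2
      (((volume : Measure ℝ).restrict (Ioo 0 T)).prod volume)) atTop (𝓝 0))
    (hθ₀ : MemLp θ₀ 2 volume) (hg : ∀ n, MemLp (g n) 2 volume)
    (hgθ₀ : Tendsto (fun n => eLpNorm (g n - θ₀) 2 volume) atTop (𝓝 0)) :
    IsWeakScalarTransportOn T κ u θ₀ W := by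
  set μ : Measure (ℝ × UnitAddTorus d) :=
    ((volume : Measure ℝ).restrict (Ioo 0 T)).prod (volume : Measure (UnitAddTorus d)) with hμ
  haveI : IsFiniteMeasure ((volume : Measure ℝ).restrict (Ioo 0 T)) :=
    isFiniteMeasure_restrict.2 measure_Ioo_lt_top.ne
  haveI : IsFiniteMeasure μ := by rw [hμ]; infer_instance
  -- the drift: measurability
  have hum : AEStronglyMeasurable (uncurry u) μ :=
    FunctionSpaces.Torus.aestronglyMeasurable_uncurry_of_stLift_prod hum0
  have hWm' : AEStronglyMeasurable (uncurry W) μ :=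
    FunctionSpaces.Torus.aestronglyMeasurable_uncurry_of_stLift_prod hWm
  have hus : ∀ᵐ t ∂(volume.restrict (Ioo 0 T)), AEStronglyMeasurable (u t) volume := hum.prodMk_left
  -- `t ↦ ‖u(t)‖_{L²}` is measurable and `u ∈ L¹(0,T; L²)` by Cauchy–Schwarz in time
  have hu12 : AEMeasurable (fun t => (∫⁻ x, ‖u t x‖ₑ ^ 2) ^ (1 / 2 : ℝ)) ((volume : Measure ℝ).restrict (Ioo 0 T)) :=
    (hum.aemeasurable.enorm.pow_const 2).lintegral_prod_right'.pow_const _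
  have hL1 : ∫⁻ t in Ioo 0 T, (∫⁻ x, ‖u t x‖ₑ ^ 2) ^ (1 / 2 : ℝ) < ⊤ := by
    have hpt : ∀ x : ℝ≥0∞, x ^ (1 / 2 : ℝ) ≤ 1 + x := fun x => by
      rcases le_total x 1 with hx | hx
      · calc x ^ (1 / 2 : ℝ) ≤ 1 ^ (1 / 2 : ℝ) := ENNReal.rpow_le_rpow hx (by norm_num)
          _ = 1 := ENNReal.one_rpow _
          _ ≤ 1 + x := le_self_add
      · calc x ^ (1 / 2 : ℝ) ≤ x ^ (1 : ℝ) := ENNReal.rpow_le_rpow_of_exponent_le hx (by norm_num)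
          _ = x := ENNReal.rpow_one x
          _ ≤ 1 + x := le_add_self
    calc ∫⁻ t in Ioo 0 T, (∫⁻ x, ‖u t x‖ₑ ^ 2) ^ (1 / 2 : ℝ)
        ≤ ∫⁻ t in Ioo 0 T, (1 + ∫⁻ x, ‖u t x‖ₑ ^ 2) := lintegral_mono fun t => hpt _
      _ = (∫⁻ _ in Ioo 0 T, (1 : ℝ≥0∞)) + ∫⁻ t in Ioo 0 T, ∫⁻ x, ‖u t x‖ₑ ^ 2 :=
          lintegral_add_left' aemeasurable_const _
      _ < ⊤ := ENNReal.add_lt_top.2 ⟨by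
          rw [lintegral_const]
          exact ENNReal.mul_lt_top ENNReal.one_lt_top (measure_lt_top _ _), hu2⟩
  refine ⟨hWm, hum0, ⟨C, hWb⟩, ?_, ?_, hdiv, fun ψ hψ => ?_⟩
  · -- `u ∈ L¹(0,T; L²)` (Cauchy–Schwarz in time on the finite interval)
    exact hL1
  · -- `u W ∈ L¹((0,T) × T^d)` (Cauchy–Schwarz slicewise, then in time)
    have hWs : ∀ᵐ t ∂(volume.restrict (Ioo 0 T)), AEStronglyMeasurable (W t) volume := hWm'.prodMk_left
    calc ∫⁻ t in Ioo 0 T, ∫⁻ x, ‖u t x‖ₑ * ‖W t x‖ₑ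
        ≤ ∫⁻ t in Ioo 0 T, (∫⁻ x, ‖u t x‖ₑ ^ 2) ^ (1 / 2 : ℝ) * (C : ℝ≥0∞) ^ (1 / 2 : ℝ) := by
          refine lintegral_mono_ae ?_
          filter_upwards [hWb, hWs, hus] with t htW htm hutm
          calc ∫⁻ x, ‖u t x‖ₑ * ‖W t x‖ₑ
              ≤ (∫⁻ x, ‖u t x‖ₑ ^ (2 : ℝ)) ^ (1 / (2 : ℝ)) * (∫⁻ x, ‖W t x‖ₑ ^ (2 : ℝ)) ^ (1 / (2 : ℝ)) :=
                ENNReal.lintegral_mul_le_Lp_mul_Lq volume Real.HolderConjugate.two_two hutm.enorm htm.enorm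
            _ ≤ (∫⁻ x, ‖u t x‖ₑ ^ 2) ^ (1 / 2 : ℝ) * (C : ℝ≥0∞) ^ (1 / 2 : ℝ) := by
                have e2 : ∀ f : UnitAddTorus d → ℝ≥0∞, (∫⁻ x, f x ^ (2 : ℝ)) = ∫⁻ x, f x ^ 2 := fun f => by
                  simp_rw [ENNReal.rpow_two]
                rw [e2, e2]
                gcongr
      _ = (∫⁻ t in Ioo 0 T, (∫⁻ x, ‖u t x‖ₑ ^ 2) ^ (1 / 2 : ℝ)) * (C : ℝ≥0∞) ^ (1 / 2 : ℝ) :=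
          lintegral_mul_const'' _ hu12
      _ < ⊤ := ENNReal.mul_lt_top hL1 (ENNReal.rpow_lt_top_of_nonneg (by norm_num) ENNReal.coe_ne_top)
  · -- the weak formulation in the limit
    set G : ℝ → UnitAddTorus d → ℝ := fun t x =>
      FunctionSpaces.Torus.timeDeriv ψ t x + ⟪u t x, FunctionSpaces.Torus.gradient (ψ t) x⟫_ℝ +
        κ * FunctionSpaces.Torus.laplacian (ψ t) x with hG
    set H : ℕ → ℝ → UnitAddTorus d → ℝ := fun n t x =>
      ⟪v n t x - u t x, FunctionSpaces.Torus.gradient (ψ t) x⟫_ℝ with hH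
    change (∫ t in Ioo 0 T, ∫ x, W t x * G t x) + ∫ x, θ₀ x * ψ 0 x = 0
    -- bounds on the test function
    obtain ⟨C₁, hC₁⟩ := exists_bound_of_continuous_uncurry hψ.continuous_uncurry_timeDeriv 0 T
    obtain ⟨C₂, hC₂⟩ := exists_bound_of_continuous_uncurry hψ.continuous_uncurry_gradient 0 T
    obtain ⟨C₃, hC₃⟩ := exists_bound_of_continuous_uncurry hψ.continuous_uncurry_laplacian 0 T
    have hψc : Continuous (uncurry ψ) := FunctionSpaces.Torus.continuous_uncurry_of_continuous_stLift hψ.1.continuous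
    obtain ⟨C₀, hC₀⟩ := exists_bound_of_continuous_uncurry hψc 0 0
    have hψ0 : ∀ x, ‖ψ 0 x‖ ≤ C₀ := fun x => hC₀ 0 (left_mem_Icc.2 le_rfl) x
    have hψ0c : Continuous (ψ 0) := hψc.comp (Continuous.prodMk_right 0)
    have hae : ∀ᵐ p ∂μ, p.1 ∈ Ioo 0 T :=
      (Measure.quasiMeasurePreserving_fst (μ := (volume : Measure ℝ).restrict (Ioo 0 T))
        (ν := (volume : Measure (UnitAddTorus d)))).ae (ae_restrict_mem measurableSet_Ioo)
    -- `G` is square integrable on `(0,T) × T^d`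
    set a : ℝ := C₁ + |κ| * C₃ with ha
    have hGbd : ∀ᵐ p ∂μ, ‖G p.1 p.2‖ₑ ≤ ENNReal.ofReal a + ENNReal.ofReal |C₂| * ‖u p.1 p.2‖ₑ := by
      filter_upwards [hae] with p hp
      have hp' : p.1 ∈ Icc 0 T := Ioo_subset_Icc_self hp
      have h1 : ‖FunctionSpaces.Torus.timeDeriv ψ p.1 p.2‖ ≤ C₁ := hC₁ p.1 hp' p.2
      have h2 : ‖⟪u p.1 p.2, FunctionSpaces.Torus.gradient (ψ p.1) p.2⟫_ℝ‖ ≤ |C₂| * ‖u p.1 p.2‖ := by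
        rw [mul_comm]
        exact (norm_inner_le_norm _ _).trans (mul_le_mul_of_nonneg_left ((hC₂ p.1 hp' p.2).trans (le_abs_self _))
          (norm_nonneg _))
      have h3 : ‖κ * FunctionSpaces.Torus.laplacian (ψ p.1) p.2‖ ≤ |κ| * C₃ := by
        rw [norm_mul, Real.norm_eq_abs]
        exact mul_le_mul_of_nonneg_left (hC₃ p.1 hp' p.2) (abs_nonneg _)
      have h4 : ‖G p.1 p.2‖ ≤ a + |C₂| * ‖u p.1 p.2‖ :=
        calc ‖G p.1 p.2‖ ≤ ‖FunctionSpaces.Torus.timeDeriv ψ p.1 p.2‖ +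
              ‖⟪u p.1 p.2, FunctionSpaces.Torus.gradient (ψ p.1) p.2⟫_ℝ‖ + ‖κ * FunctionSpaces.Torus.laplacian (ψ p.1) p.2‖ :=
              norm_add₃_le
          _ ≤ a + |C₂| * ‖u p.1 p.2‖ := by rw [ha]; linarith
      have ha0 : 0 ≤ a := by
        have h01 := (norm_nonneg _).trans (hC₁ p.1 hp' p.2)
        have h03 := (norm_nonneg _).trans (hC₃ p.1 hp' p.2)
        rw [ha]; positivity
      rw [← ofReal_norm, ← ofReal_norm, ← ENNReal.ofReal_mul (abs_nonneg _), ← ENNReal.ofReal_add ha0 (by positivity)]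
      exact ENNReal.ofReal_le_ofReal h4
    have hGm : AEStronglyMeasurable (uncurry G) μ := by
      change AEStronglyMeasurable (fun p : ℝ × UnitAddTorus d =>
        FunctionSpaces.Torus.timeDeriv ψ p.1 p.2 + ⟪u p.1 p.2, FunctionSpaces.Torus.gradient (ψ p.1) p.2⟫_ℝ +
          κ * FunctionSpaces.Torus.laplacian (ψ p.1) p.2) μ
      refine ((?_ : AEStronglyMeasurable _ μ).add ?_).add ?_
      · exact hψ.continuous_uncurry_timeDeriv.aestronglyMeasurable
      · exact hum.inner hψ.continuous_uncurry_gradient.aestronglyMeasurable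
      · exact (continuous_const.mul hψ.continuous_uncurry_laplacian).aestronglyMeasurable
    have hue : AEMeasurable (fun p : ℝ × UnitAddTorus d => ‖u p.1 p.2‖ₑ ^ 2) μ := hum.aemeasurable.enorm.pow_const 2
    have hu2μ : ∫⁻ p, ‖u p.1 p.2‖ₑ ^ 2 ∂μ < ⊤ := by
      have e : ∫⁻ p, ‖u p.1 p.2‖ₑ ^ 2 ∂μ = ∫⁻ t in Ioo 0 T, ∫⁻ x, ‖u t x‖ₑ ^ 2 := lintegral_prod _ hue
      rw [e]
      exact hu2
    have hG2 : ∫⁻ t in Ioo 0 T, ∫⁻ x, ‖G t x‖ₑ ^ 2 < ⊤ := by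
      have h1 : ∫⁻ p, ‖uncurry G p‖ₑ ^ 2 ∂μ ≤
          ∫⁻ p, (2 * ENNReal.ofReal a ^ 2 + 2 * (ENNReal.ofReal |C₂| ^ 2 * ‖u p.1 p.2‖ₑ ^ 2)) ∂μ := by
        refine lintegral_mono_ae ?_
        filter_upwards [hGbd] with p hp
        calc ‖uncurry G p‖ₑ ^ 2 ≤ (ENNReal.ofReal a + ENNReal.ofReal |C₂| * ‖u p.1 p.2‖ₑ) ^ 2 := by
              gcongr; exact hp
          _ ≤ 2 * ENNReal.ofReal a ^ 2 + 2 * (ENNReal.ofReal |C₂| * ‖u p.1 p.2‖ₑ) ^ 2 :=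
              FunctionSpaces.Torus.ennreal_add_sq_le _ _
          _ = 2 * ENNReal.ofReal a ^ 2 + 2 * (ENNReal.ofReal |C₂| ^ 2 * ‖u p.1 p.2‖ₑ ^ 2) := by rw [mul_pow]
      have h2 : ∫⁻ p, (2 * ENNReal.ofReal a ^ 2 + 2 * (ENNReal.ofReal |C₂| ^ 2 * ‖u p.1 p.2‖ₑ ^ 2)) ∂μ < ⊤ := by
        rw [lintegral_add_left' aemeasurable_const, lintegral_const,
          lintegral_const_mul'' _ (hue.const_mul _), lintegral_const_mul'' _ hue]
        refine ENNReal.add_lt_top.2 ⟨ENNReal.mul_lt_top (ENNReal.mul_lt_top ENNReal.ofNat_lt_top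
          (ENNReal.pow_lt_top ENNReal.ofReal_lt_top)) (measure_lt_top _ _), ?_⟩
        exact ENNReal.mul_lt_top ENNReal.ofNat_lt_top (ENNReal.mul_lt_top (ENNReal.pow_lt_top ENNReal.ofReal_lt_top) hu2μ)
      rw [lintegral_prod _ (hGm.aemeasurable.enorm.pow_const 2)] at h1
      exact lt_of_le_of_lt h1 h2
    have hGst : AEStronglyMeasurable (FunctionSpaces.Torus.stLift G) (volume.restrict (Ioo 0 T ×ˢ univ)) :=
      FunctionSpaces.Torus.aestronglyMeasurable_stLift_of_uncurry hGm
    -- (a) the weak convergence `∫∫ θₙ G → ∫∫ W G`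
    have hA := hlim G hGst hG2
    -- (b) the splitting of the `n`-th weak identity
    set B : ℝ≥0∞ := (C : ℝ≥0∞) * volume (Ioo (0 : ℝ) T) with hB
    have hBfin : B < ⊤ := ENNReal.mul_lt_top ENNReal.coe_lt_top measure_Ioo_lt_top
    have hθfin : ∀ n, ∫⁻ t in Ioo 0 T, ∫⁻ x, ‖θ n t x‖ₑ ^ 2 ≤ B := fun n =>
      calc ∫⁻ t in Ioo 0 T, ∫⁻ x, ‖θ n t x‖ₑ ^ 2 ≤ ∫⁻ _ in Ioo (0 : ℝ) T, (C : ℝ≥0∞) := lintegral_mono_ae (hbd n)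
        _ = B := by rw [lintegral_const, Measure.restrict_apply_univ]
    have hGmem : MemLp (uncurry G) 2 μ := (FunctionSpaces.Torus.memLp_two_uncurry hGm hG2).1
    have hθG : ∀ n, Integrable (fun p : ℝ × UnitAddTorus d => θ n p.1 p.2 * G p.1 p.2) μ := fun n => by
      have hθmem : MemLp (uncurry (θ n)) 2 μ :=
        (FunctionSpaces.Torus.memLp_two_uncurry (hsol n).aestronglyMeasurable_uncurry ((hθfin n).trans_lt hBfin)).1
      have h := memLp_one_iff_integrable.1 (MemLp.mul (r := 1) hGmem hθmem)
      exact h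
    have hθGn : ∀ n, Integrable (fun p : ℝ × UnitAddTorus d => θ n p.1 p.2 *
        (FunctionSpaces.Torus.timeDeriv ψ p.1 p.2 + ⟪v n p.1 p.2, FunctionSpaces.Torus.gradient (ψ p.1) p.2⟫_ℝ +
          κ * FunctionSpaces.Torus.laplacian (ψ p.1) p.2)) μ := fun n =>
      (hsol n).integrable_weakIntegrand hψ
    have hsplit : ∀ n (p : ℝ × UnitAddTorus d), θ n p.1 p.2 *
        (FunctionSpaces.Torus.timeDeriv ψ p.1 p.2 + ⟪v n p.1 p.2, FunctionSpaces.Torus.gradient (ψ p.1) p.2⟫_ℝ +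
          κ * FunctionSpaces.Torus.laplacian (ψ p.1) p.2) =
        θ n p.1 p.2 * G p.1 p.2 + θ n p.1 p.2 * H n p.1 p.2 := by
      intro n p
      simp only [hG, hH, inner_sub_left]
      ring
    have hθH : ∀ n, Integrable (fun p : ℝ × UnitAddTorus d => θ n p.1 p.2 * H n p.1 p.2) μ := by
      intro n
      have h := (hθGn n).sub (hθG n)
      refine h.congr (Eventually.of_forall fun p => ?_)
      simp only [Pi.sub_apply, hsplit n p, add_sub_cancel_left]
    have hident : ∀ n, (∫ t in Ioo 0 T, ∫ x, θ n t x * G t x) =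
        -(∫ p, θ n p.1 p.2 * H n p.1 p.2 ∂μ) - ∫ x, g n x * ψ 0 x := by
      intro n
      have h0 := (hsol n).integral_prod_weak_eq hψ
      have h1 : (∫ p, θ n p.1 p.2 *
          (FunctionSpaces.Torus.timeDeriv ψ p.1 p.2 + ⟪v n p.1 p.2, FunctionSpaces.Torus.gradient (ψ p.1) p.2⟫_ℝ +
            κ * FunctionSpaces.Torus.laplacian (ψ p.1) p.2) ∂μ) =
          (∫ p, θ n p.1 p.2 * G p.1 p.2 ∂μ) + ∫ p, θ n p.1 p.2 * H n p.1 p.2 ∂μ := by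
        rw [← integral_add (hθG n) (hθH n)]
        exact integral_congr_ae (Eventually.of_forall fun p => hsplit n p)
      have h2 : (∫ p, θ n p.1 p.2 * G p.1 p.2 ∂μ) = ∫ t in Ioo 0 T, ∫ x, θ n t x * G t x :=
        integral_prod _ (hθG n)
      rw [h1, h2] at h0
      linarith
    -- (c) the transport error `∫∫ θₙ ⟪vₙ - u, ∇ψ⟫ → 0`
    have hθ2 : ∀ n, eLpNorm (uncurry (θ n)) 2 μ ≤ B ^ (1 / 2 : ℝ) := by
      intro n
      have hfin := hθfin n
      have h := (FunctionSpaces.Torus.memLp_two_uncurry (hsol n).aestronglyMeasurable_uncurry (hfin.trans_lt hBfin)).2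
      rw [FunctionSpaces.eLpNorm_two_eq_pow_two_rpow_half, h]
      exact ENNReal.rpow_le_rpow hfin (by norm_num)
    set K : ℝ := |C₂| with hK
    have hvum : ∀ n, AEStronglyMeasurable (fun q : ℝ × UnitAddTorus d => v n q.1 q.2 - u q.1 q.2) μ := fun n =>
      (hsol n).aestronglyMeasurable_uncurry_velocity.sub hum
    have hJbound : ∀ n, eLpNorm (fun q : ℝ × UnitAddTorus d => v n q.1 q.2 - u q.1 q.2) 2 μ < ⊤ →
        ‖∫ p, θ n p.1 p.2 * H n p.1 p.2 ∂μ‖ ≤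
        (ENNReal.ofReal K * (B ^ (1 / 2 : ℝ) *
          eLpNorm (fun q : ℝ × UnitAddTorus d => v n q.1 q.2 - u q.1 q.2) 2 μ)).toReal := by
      intro n hfin
      have h1 : ‖∫ p, θ n p.1 p.2 * H n p.1 p.2 ∂μ‖ ≤
          (∫⁻ p, ‖θ n p.1 p.2 * H n p.1 p.2‖ₑ ∂μ).toReal := by
        rw [← integral_norm_eq_lintegral_enorm (hθH n).1]
        exact norm_integral_le_integral_norm _
      refine h1.trans (ENNReal.toReal_mono (ENNReal.mul_ne_top ENNReal.ofReal_ne_top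
        (ENNReal.mul_ne_top (ENNReal.rpow_ne_top_of_nonneg (by norm_num) hBfin.ne) hfin.ne)) ?_)
      have h2 : ∫⁻ p, ‖θ n p.1 p.2 * H n p.1 p.2‖ₑ ∂μ ≤
          ∫⁻ p, ENNReal.ofReal K * (‖θ n p.1 p.2‖ₑ * ‖v n p.1 p.2 - u p.1 p.2‖ₑ) ∂μ := by
        refine lintegral_mono_ae ?_
        filter_upwards [hae] with p hp
        have hp' : p.1 ∈ Icc 0 T := Ioo_subset_Icc_self hp
        have hin : ‖H n p.1 p.2‖ₑ ≤ ‖v n p.1 p.2 - u p.1 p.2‖ₑ * ENNReal.ofReal K := by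
          rw [hH, ← ofReal_norm, ← ofReal_norm, ← ENNReal.ofReal_mul (norm_nonneg _)]
          refine ENNReal.ofReal_le_ofReal ?_
          exact (norm_inner_le_norm _ _).trans (mul_le_mul_of_nonneg_left
            ((hC₂ p.1 hp' p.2).trans (le_abs_self _)) (norm_nonneg _))
        rw [enorm_mul]
        calc ‖θ n p.1 p.2‖ₑ * ‖H n p.1 p.2‖ₑ
            ≤ ‖θ n p.1 p.2‖ₑ * (‖v n p.1 p.2 - u p.1 p.2‖ₑ * ENNReal.ofReal K) := by gcongr
          _ = ENNReal.ofReal K * (‖θ n p.1 p.2‖ₑ * ‖v n p.1 p.2 - u p.1 p.2‖ₑ) := by ring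
      refine h2.trans ?_
      rw [lintegral_const_mul' _ _ ENNReal.ofReal_ne_top]
      gcongr
      have h3 := ENNReal.lintegral_mul_le_Lp_mul_Lq μ Real.HolderConjugate.two_two
        (hsol n).aestronglyMeasurable_uncurry.enorm (hvum n).enorm
      calc ∫⁻ p, ‖θ n p.1 p.2‖ₑ * ‖v n p.1 p.2 - u p.1 p.2‖ₑ ∂μ
          ≤ (∫⁻ p, ‖uncurry (θ n) p‖ₑ ^ (2 : ℝ) ∂μ) ^ (1 / (2 : ℝ)) *
            (∫⁻ p : ℝ × UnitAddTorus d, ‖v n p.1 p.2 - u p.1 p.2‖ₑ ^ (2 : ℝ) ∂μ) ^ (1 / (2 : ℝ)) := h3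
        _ = eLpNorm (uncurry (θ n)) 2 μ * eLpNorm (fun q : ℝ × UnitAddTorus d => v n q.1 q.2 - u q.1 q.2) 2 μ := by
            rw [FunctionSpaces.lintegral_rpow_two_eq_eLpNorm, FunctionSpaces.lintegral_rpow_two_eq_eLpNorm]
        _ ≤ B ^ (1 / 2 : ℝ) * eLpNorm (fun q : ℝ × UnitAddTorus d => v n q.1 q.2 - u q.1 q.2) 2 μ := by
            gcongr
            exact hθ2 n
    have hJ : Tendsto (fun n => ∫ p, θ n p.1 p.2 * H n p.1 p.2 ∂μ) atTop (𝓝 0) := by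
      have hlim0 : Tendsto (fun n => (ENNReal.ofReal K * (B ^ (1 / 2 : ℝ) *
          eLpNorm (fun q : ℝ × UnitAddTorus d => v n q.1 q.2 - u q.1 q.2) 2 μ)).toReal) atTop (𝓝 0) := by
        have h1 := ENNReal.Tendsto.const_mul hv (Or.inr (ENNReal.rpow_ne_top_of_nonneg (by norm_num) hBfin.ne))
          (a := B ^ (1 / 2 : ℝ))
        rw [mul_zero] at h1
        have h2 := ENNReal.Tendsto.const_mul h1 (Or.inr ENNReal.ofReal_ne_top) (a := ENNReal.ofReal K)
        rw [mul_zero] at h2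
        have h3 := (ENNReal.tendsto_toReal ENNReal.zero_ne_top).comp h2
        rwa [ENNReal.toReal_zero] at h3
      have hev : ∀ᶠ n in atTop, eLpNorm (fun q : ℝ × UnitAddTorus d => v n q.1 q.2 - u q.1 q.2) 2 μ < ⊤ :=
        (tendsto_order.1 hv).2 ⊤ ENNReal.zero_lt_top
      exact squeeze_zero_norm' (hev.mono fun n hn => hJbound n hn) hlim0
    -- (d) the datum term `∫ gₙ ψ(0) → ∫ θ₀ ψ(0)`
    have hD : Tendsto (fun n => ∫ x, g n x * ψ 0 x) atTop (𝓝 (∫ x, θ₀ x * ψ 0 x)) := by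
      have hψ0m : AEStronglyMeasurable (ψ 0) volume := hψ0c.aestronglyMeasurable
      have hI0 : Integrable (fun x => θ₀ x * ψ 0 x) volume :=
        (hθ₀.integrable one_le_two).mul_bdd hψ0m (Eventually.of_forall hψ0)
      have hIn : ∀ n, Integrable (fun x => g n x * ψ 0 x) volume := fun n =>
        ((hg n).integrable one_le_two).mul_bdd hψ0m (Eventually.of_forall hψ0)
      have hbound : ∀ n, ‖(∫ x, g n x * ψ 0 x) - ∫ x, θ₀ x * ψ 0 x‖ ≤
          (ENNReal.ofReal C₀ * eLpNorm (g n - θ₀) 2 volume).toReal := by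
        intro n
        rw [← integral_sub (hIn n) hI0]
        have hm : AEStronglyMeasurable (fun x => g n x * ψ 0 x - θ₀ x * ψ 0 x) volume := ((hIn n).sub hI0).1
        have h1 : ‖∫ x, (g n x * ψ 0 x - θ₀ x * ψ 0 x)‖ ≤
            (∫⁻ x, ‖g n x * ψ 0 x - θ₀ x * ψ 0 x‖ₑ).toReal := by
          rw [← integral_norm_eq_lintegral_enorm hm]
          exact norm_integral_le_integral_norm _
        refine h1.trans (ENNReal.toReal_mono
          (ENNReal.mul_ne_top ENNReal.ofReal_ne_top ((hg n).sub hθ₀).eLpNorm_ne_top) ?_)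
        calc ∫⁻ x, ‖g n x * ψ 0 x - θ₀ x * ψ 0 x‖ₑ ≤ ∫⁻ x, ENNReal.ofReal C₀ * ‖(g n - θ₀) x‖ₑ := by
              refine lintegral_mono fun x => ?_
              rw [← sub_mul, enorm_mul, mul_comm, Pi.sub_apply]
              gcongr
              rw [← ofReal_norm]
              exact ENNReal.ofReal_le_ofReal (hψ0 x)
          _ = ENNReal.ofReal C₀ * eLpNorm (g n - θ₀) 1 volume := by
              rw [lintegral_const_mul' _ _ ENNReal.ofReal_ne_top, eLpNorm_one_eq_lintegral_enorm]
          _ ≤ ENNReal.ofReal C₀ * eLpNorm (g n - θ₀) 2 volume := by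
              gcongr
              exact eLpNorm_le_eLpNorm_of_exponent_le one_le_two ((hg n).sub hθ₀).1
      have hlim0 : Tendsto (fun n => (ENNReal.ofReal C₀ * eLpNorm (g n - θ₀) 2 volume).toReal) atTop (𝓝 0) := by
        have h := ENNReal.Tendsto.const_mul hgθ₀ (Or.inr ENNReal.ofReal_ne_top) (a := ENNReal.ofReal C₀)
        rw [mul_zero] at h
        have h' := (ENNReal.tendsto_toReal ENNReal.zero_ne_top).comp h
        rwa [ENNReal.toReal_zero] at h'
      rw [tendsto_iff_norm_sub_tendsto_zero]
      exact squeeze_zero (fun n => norm_nonneg _) hbound hlim0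
    -- (e) conclusion: `∫∫ W G = lim ∫∫ θₙ G = -lim (Jₙ + Dₙ) = -∫ θ₀ ψ(0)`
    have hA' : Tendsto (fun n => ∫ t in Ioo 0 T, ∫ x, θ n t x * G t x) atTop
        (𝓝 (-(0 : ℝ) - ∫ x, θ₀ x * ψ 0 x)) :=
      (hJ.neg.sub hD).congr fun n => (hident n).symm
    rw [tendsto_nhds_unique hA hA']
    ring

end Limit

end Torus

end Literature.Analysis.FluidPDE
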